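import Mathlib
import Literature.Analysis.ODE.SmoothFieldTaylorCoefficients
import Summits.NavierStokesRegularity.NavierStokesRegularity.Theorems.TaoLadderRungTwoBreakOneShiftWindowTermFieldSmooth
import HarnessLib

/-!
# The one-shift window system, XXIII: the TAYLOR JET RECURSION of a term-list field IS the Lie–Taylor flow
# coefficient recursion — the real-side target of the checker's state jets (cell harvest/h2-tao-ladder, seat p2;
# rung1/KERNEL-CHEAP-REPLAY-SPEC.md §2 (a)/(b) (thin/box jets), §7 (R2); support for K1(1) = `NoSurvivingDSSOne`,
# stmt-NavierStokesRegularity-20205)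

MODEL lattice ODEs only (Tao 2016 §4 normal form on Tao's shift set `S`); nothing here is a statement about
the Navier–Stokes equations; no item is closed; nothing numerical is proved. Generic in `ι`, `κ`.

`Literature.Analysis.ODE.SmoothFieldTaylorCoefficients` provides, for a smooth field `f` on an open `Ω`, the flow
Taylor coefficient maps `Φ_k = smoothTaylorMap hf k` (`Φ_k = (1/k!) L_f^k Id`), with every structural hypothesis of
the high-order enclosure theorems discharged (`highOrderEnclosure_step_smooth`) and the identification
`(1/k!) y^{(k)}(t) = Φ_k(y(t))` for every solution (`taylorCoeff_solution_eq_smoothTaylorMap`). What a replay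
COMPUTES are interval Taylor jets by the Cauchy-product recursion over the term list (SPEC §2 (a)/(b); p1's
`jetLevelsA`). This file proves that recursion for the REAL coefficient maps of a term-list field (part XVIII), so
that an interval evaluation of it encloses `Φ_k` over a box by plain interval-arithmetic soundness:

* `tjet T k x := smoothTaylorMap (termField T) k x` on `Ω = ⊤` (the field is `C^∞`, part XXI); `tjet_zero`;
* `Factor.jetVal` — the jet of a factor: the state jet for a coordinate, `(e, 0, 0, …)` for an external value;
* `tjet_succ` — **`(k+1) · Φ_{k+1}(x)_i = Σ_terms [out = i] coef · Σ_{p+q=k} jet(fa)_p(x) · jet(fb)_q(x)`**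
  (Moore's shift rule `lieCoeff_succ` + the Leibniz/Cauchy rule `lieCoeff_mul` of
  `Literature.Analysis.ODE.LieSeriesTaylorCoefficients`, applied to `L_f X_i = Σ coef · FA · FB` in `C^∞(Ω)`).
-/

noncomputable section

-- the sub-problem namespace repeats the summit name by design (D-0017)
set_option linter.dupNamespace false

namespace Summit.NavierStokesRegularity.NavierStokesRegularity.Theorems

namespace DSSOneShift

open Set Metric Literature.Analysis.ODE TopologicalSpace
open scoped ContDiff

variable {ι : Type*} [Fintype ι] [DecidableEq ι] {κ : Type*} [Fintype κ]

/-- A term-list field is `C^∞` on the whole space, in the form `SmoothFieldTaylorCoefficients` consumes. [folklore] -/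
theorem termField_contDiffOn (T : κ → BTerm ι) :
    ContDiffOn ℝ ∞ (termField T) ((⊤ : Opens (ι → ℝ)) : Set (ι → ℝ)) :=
  ((contDiff_termField T).of_le le_top).contDiffOn

/-- **The flow Taylor coefficient maps of a term-list field**: `tjet T k = Φ_k = (1/k!) L_f^k Id` for
`f = termField T`. [cite: HairerWannerLubich2002, §III.5.1 eq. (5.8); Moore1979, §3.4 eq. (3.13)] -/
def tjet (T : κ → BTerm ι) (k : ℕ) (x : ι → ℝ) : ι → ℝ :=
  smoothTaylorMap (Ω := ⊤) (termField_contDiffOn T) k x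

omit [DecidableEq ι] in
/-- `Φ_0 = Id`. [cite: Moore1979, §3.4 eq. (3.14)] -/
theorem tjet_zero [DecidableEq ι] (T : κ → BTerm ι) (x : ι → ℝ) : tjet T 0 x = x :=
  smoothTaylorMap_zero _ x

/-! ### Factors inside `C^∞(Ω)` -/

namespace Factor

/-- A factor as an element of `C^∞(Ω)`: a coordinate function or a constant. [folklore] -/
def sfun : Factor ι → SmoothFun (⊤ : Opens (ι → ℝ))
  | coord c => SmoothFun.coord ⊤ c
  | ext e => algebraMap ℝ _ e

omit [DecidableEq ι] in
/-- Its value is the factor's value. [folklore] -/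
@[simp] theorem sfun_apply (φ : Factor ι) (x : (⊤ : Opens (ι → ℝ))) : φ.sfun x = φ.val (x : ι → ℝ) := by
  cases φ with
  | coord c => rfl
  | ext e => rfl

/-- The jet of a factor: the state jet for a coordinate, `(e, 0, 0, …)` for an external value. [folklore] -/
def jetVal (T : κ → BTerm ι) (φ : Factor ι) (p : ℕ) (x : ι → ℝ) : ℝ :=
  match φ with
  | coord c => tjet T p x c
  | ext e => if p = 0 then e else 0

end Factor

omit [DecidableEq ι] in
/-- Evaluation of a finite sum in `C^∞(Ω)`. [folklore] -/
theorem smoothFun_sum_apply {Ω : Opens (ι → ℝ)} {σ : Type*} (s : Finset σ) (g : σ → SmoothFun Ω) (x : Ω) :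
    (∑ k ∈ s, g k) x = ∑ k ∈ s, g k x := by
  classical
  induction s using Finset.induction_on with
  | empty => simp
  | insert a s ha ih => rw [Finset.sum_insert ha, Finset.sum_insert ha, SmoothFun.add_apply, ih]

omit [DecidableEq ι] in
/-- Lie coefficients of a finite sum. [cite: Moore1979, §3.4 eq. (3.18)] -/
theorem lieCoeff_finset_sum {Ω : Opens (ι → ℝ)} (D : Derivation ℝ (SmoothFun Ω) (SmoothFun Ω)) (k : ℕ)
    {σ : Type*} (s : Finset σ) (g : σ → SmoothFun Ω) :
    lieCoeff D k (∑ a ∈ s, g a) = ∑ a ∈ s, lieCoeff D k (g a) := by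
  classical
  induction s using Finset.induction_on with
  | empty => simp
  | insert a s ha ih => rw [Finset.sum_insert ha, Finset.sum_insert ha, lieCoeff_add, ih]

/-- The Lie coefficients of a factor are its jet. [cite: Moore1979, §3.4 eqs. (3.13)/(3.18)] -/
theorem lieCoeff_sfun (T : κ → BTerm ι) (φ : Factor ι) (p : ℕ) (x : (⊤ : Opens (ι → ℝ))) :
    lieCoeff (lieDerivationOn (termField_contDiffOn T)) p φ.sfun x = φ.jetVal T p (x : ι → ℝ) := by
  cases φ with
  | coord c =>
    simp only [Factor.sfun, Factor.jetVal, tjet]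
    rw [smoothTaylorMap_of_mem _ p x.2]
    rfl
  | ext e =>
    cases p with
    | zero => simp [Factor.sfun, Factor.jetVal]
    | succ p => simp [Factor.sfun, Factor.jetVal, lieCoeff_succ_algebraMap]

/-- **`L_f X_i = Σ_terms [out = i] coef · FA · FB` in `C^∞(Ω)`** for `f = termField T`. [cite: HairerWannerLubich2002, §III.5.1 eq. (5.3); cell vocabulary, harvest/h2-tao-ladder rung1/KERNEL-CHEAP-REPLAY-SPEC.md §1 (term list)] -/
theorem lieDerivationOn_coord_termField (T : κ → BTerm ι) (i : ι) :
    lieDerivationOn (termField_contDiffOn T) (SmoothFun.coord ⊤ i) =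
      ∑ k, (T k).coefAt i • ((T k).fa.sfun * (T k).fb.sfun) := by
  ext x
  rw [lieDerivationOn_coord, smoothFun_sum_apply]
  simp only [SmoothFun.smul_apply, SmoothFun.mul_apply, Factor.sfun_apply, termField]
  exact Finset.sum_congr rfl fun k _ => by ring

/-- **THE JET RECURSION.** For `f = termField T` and every `x`, `i`, `k`:
`(k+1) · Φ_{k+1}(x)_i = Σ_terms [out = i] coef · Σ_{p+q=k} jet(fa)_p(x) · jet(fb)_q(x)` — the Cauchy-product
recursion the replay evaluates in interval arithmetic (SPEC §2 (a)/(b)); with `tjet_zero` it determines all `Φ_k`.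
[cite: Moore1979, §3.4 eqs. (3.17)–(3.18); HairerWannerLubich2002, §III.5.1 eq. (5.8)] -/
theorem tjet_succ (T : κ → BTerm ι) (k : ℕ) (x : ι → ℝ) (i : ι) :
    ((k : ℝ) + 1) * tjet T (k + 1) x i =
      ∑ t, (T t).coefAt i *
        ∑ pq ∈ Finset.HasAntidiagonal.antidiagonal k, (T t).fa.jetVal T pq.1 x * (T t).fb.jetVal T pq.2 x := by
  set D := lieDerivationOn (termField_contDiffOn T) with hD
  have hx : x ∈ (⊤ : Opens (ι → ℝ)) := Opens.mem_top x
  set X : (⊤ : Opens (ι → ℝ)) := ⟨x, hx⟩ with hX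
  -- the shift rule, evaluated at `x`
  have hshift := lieCoeff_succ D k (SmoothFun.coord ⊤ i)
  have hval : tjet T (k + 1) x i = lieCoeff D (k + 1) (SmoothFun.coord ⊤ i) X := by
    simp only [tjet]
    rw [smoothTaylorMap_of_mem _ (k + 1) hx]
    rfl
  have hlhs : ((k : ℝ) + 1) * tjet T (k + 1) x i = ((k + 1) • lieCoeff D (k + 1) (SmoothFun.coord ⊤ i)) X := by
    rw [hval, ← Nat.cast_smul_eq_nsmul ℝ, SmoothFun.smul_apply]
    push_cast
    ring
  rw [hlhs, hshift, lieDerivationOn_coord_termField, lieCoeff_finset_sum, smoothFun_sum_apply]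
  refine Finset.sum_congr rfl fun t _ => ?_
  rw [lieCoeff_smul, SmoothFun.smul_apply, lieCoeff_mul, smoothFun_sum_apply]
  congr 1
  refine Finset.sum_congr rfl fun pq _ => ?_
  rw [SmoothFun.mul_apply, lieCoeff_sfun, lieCoeff_sfun]

end DSSOneShift

end Summit.NavierStokesRegularity.NavierStokesRegularity.Theorems
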